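import Summits.QuantumFields.BalabanUV.T4Continuum.Support.NE7AxialGaugeStrata
import Summits.QuantumFields.BalabanUV.T4Continuum.Support.NE7AxialGaugeDerivatives
import Literature.MathematicalPhysics.QuantumFieldTheory.Balaban1983to89.MatrixLogLipschitz
import HarnessLib

/-!
# NE7AxialGaugePotential — THE AXIAL-GAUGE POTENTIAL `B = log U^{v₀}` OF A UNITARY SMALL-FIELD CONFIGURATION WITH A COVARIANT FLUX-GRADIENT BOUND:
# on the region `{y ≤ x, l1(x − y) ≤ R}` of the tree gauge based at `y` ([Balaban1985Averaging] p. 24), with plaquette radius `a` (`SmallField U a`) and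
# `‖(∇_U F)(x, κ; π)‖ ≤ b` everywhere,
#   `‖V₀(x + e_λ, ν) − V₀(x, ν)‖ ≤ δ_R`,  `‖Δ_λΔ_λ′V₀(·, ν)(x)‖ ≤ σ_R`,  `‖B‖ ≤ 2·l1(x − y)·a`,  `‖Δ_ι B‖ ≤ 2δ_R`  (and, in F4b, `‖Δ_ιΔ_ι′B‖ ≤ 2σ_R + 4δ_R²`),
# `p₁ = 2b + 2(R+1)a·a`, `δ_R = d·((R+1)p₁ + a)`, `σ_R = d·(R·(2p₁ + 2p₁δ_R) + p₁ + aδ_R)` — every term of `σ_R` carries `b` or `a²`; and `U = (expUnit ∘ B)^{u}` bondwise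
# on the region, `u = v₀⁻¹` unitary

Cell `pub-balaban`, rung (B)+1 sub-cell t4, lineage `b2b-balaban-t4-ne7-p1` (CRUX PROVER NE7 #1 = OWNER of BINDER row NE7), generation 111.  Memo
`t4/b2b-balaban-t4-ne7-p1-g111/ROAD-G111.md`.  File F4 of the line «(9)-TYPE k-UNIFORM HÖLDER REGULARITY OF EVERY CONSTRAINED SMALL-FIELD MINIMISER, every β < 1»
(ROAD-G110 §NEXT (N2)): F3 `NE7AxialGaugeDerivatives` (abstract strata induction) INSTANTIATED at `W = U^{v₀}`, `Q(x; j, ν) = W(∂p_{jν}(x))` through F2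
`NE7AxialGaugeStrata` (`axial_bond_eq_one`, `axial_rec`, `norm_plaq_diff_le`, `axial_classData`, `norm_axial_sub_one_le`), then read through the series logarithm
(`MatrixLog.mlog`, `MatrixLogLipschitz.norm_mlog_sub_mlog_le` at radius `1∕2`).
WHAT ([folklore]; 0 def, 0 sorry; every `d`, every `U(n)`).  §1 `axial_hyps` (the five structural inputs of F3 for the tree gauge), **`axial_firstDiff_le`**,
**`axial_secondDiff_le`**; §2 `axial_rep` (`U(x,κ) = (v₀⁻¹·expUnit(B)·v₀)(x,κ)` wherever `l1(x − y)·a < 1`), `norm_axialLog_le`, **`norm_axialLog_diff_le`**.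
HONEST FRAMING (page 1): elementary lattice gauge analysis of ONE configuration under displayed hypotheses; nothing of Bałaban's asserted; NOT NE3∕NE7 as spine nodes; spine
0∕9; finite T⁴ rung (B)+1 — NOT infinite volume, NOT mass gap, NOT BetaPertH, NOT Clay (continuum YM on T⁴ ⇐ BetaPertH ∧ nine spine estimates).
-/

set_option autoImplicit false

open scoped BigOperators Matrix Matrix.Norms.L2Operator
open NormedSpace Finset

namespace Summit.QuantumFields.BalabanUV.T4Continuum.NE7AxialGaugePotential

open Literature.MathematicalPhysics.QuantumFieldTheory.Balaban1983to89
open B7Prop1Explicit B7Prop2Explicit MatrixLog UnitaryModel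
open T4AveragingDeficitWall hiding Site Plane Plaq Bond
open AveragingDeficitTransport (mem_U1_of_unitary)
open MatrixLogLipschitz (norm_mlog_sub_mlog_le)
open NE7AxialGaugeStrata (axial_bond_eq_one axial_rec axialFn_unitary norm_axial_sub_one_le norm_plaq_diff_le axial_classData)
open NE7AxialGaugeLattice (l1_sub_mono add_e_apply_of_ne l1_add_e_le)
open NE7AxialGaugeDerivatives (norm_firstDiff_le norm_secondDiff_le)

noncomputable section

variable {d : ℕ} {n : Type*} [Fintype n] [DecidableEq n] [Nonempty n]

/-! ## §1 F3 instantiated at the tree gauge -/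

/-- A translate `x + e_μ` of a point of the region `{y ≤ x, l1(x − y) ≤ R}` lies in the region of radius `R + 1`. [folklore] -/
theorem region_add_e {y x : Site d} (hyx : y ≤ x) {R : ℕ} (hxR : l1 (x - y) ≤ R) (μ : Fin d) :
    y ≤ x + e μ ∧ l1 (x + e μ - y) ≤ R + 1 := by
  have hA : ∀ κ : Fin d, y κ ≤ (x + e μ) κ := by
    intro κ
    by_cases hκ : κ = μ
    · have h1 : y μ ≤ x μ := hyx μ
      have h2 : (x + e μ) μ = x μ + 1 := by rw [Pi.add_apply, e_apply, if_pos rfl]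
      rw [hκ, h2]; omega
    · rw [add_e_apply_of_ne x hκ]; exact hyx κ
  refine ⟨hA, ?_⟩
  rw [show x + e μ - y = (x - y) + e μ by abel]
  exact (l1_add_e_le _ μ).trans (by omega)

/-- **THE FIVE STRUCTURAL INPUTS OF F3 FOR THE TREE GAUGE** `W = U^{v₀}` based at `y`, `Q(x; j, ν) = W(∂p_{jν}(x))`: norms `≤ 1`, tree bonds trivial on the strata,
the one-step plaquette recursion, and `‖Q − 1‖ ≤ a`. [folklore] -/
theorem axial_hyps {U : Site d → Fin d → (Matrix n n ℂ)ˣ} (hU : IsUnitaryCfg U) {a : ℝ} (hS : SmallField U a) (y : Site d) :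
    (∀ (x : Site d) (μ : Fin d), ‖((gaugeAct (axialFn U y) U x μ : (Matrix n n ℂ)ˣ) : Matrix n n ℂ)‖ ≤ 1) ∧
    (∀ (x : Site d) (j ν : Fin d), ‖((hol (gaugeAct (axialFn U y) U) x (plaqWord j ν) : (Matrix n n ℂ)ˣ) : Matrix n n ℂ)‖ ≤ 1) ∧
    (∀ (x : Site d) (j : Fin d), (∀ κ : Fin d, κ < j → x κ = y κ) → ((gaugeAct (axialFn U y) U x j : (Matrix n n ℂ)ˣ) : Matrix n n ℂ) = 1) ∧
    (∀ (x : Site d) (j ν : Fin d), j < ν → (∀ κ : Fin d, κ < j → x κ = y κ) →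
      ((gaugeAct (axialFn U y) U (x + e j) ν : (Matrix n n ℂ)ˣ) : Matrix n n ℂ)
        = ((hol (gaugeAct (axialFn U y) U) x (plaqWord j ν) : (Matrix n n ℂ)ˣ) : Matrix n n ℂ)
          * ((gaugeAct (axialFn U y) U x ν : (Matrix n n ℂ)ˣ) : Matrix n n ℂ)) ∧
    (∀ (x : Site d) (j ν : Fin d), j < ν → ‖((hol (gaugeAct (axialFn U y) U) x (plaqWord j ν) : (Matrix n n ℂ)ˣ) : Matrix n n ℂ) - 1‖ ≤ a) := by
  have hu : ∀ z, axialFn U y z ∈ unitaryUnits (Matrix n n ℂ) := axialFn_unitary hU y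
  have hU0 : IsUnitaryCfg (gaugeAct (axialFn U y) U) := AveragingDeficitKDatum.isUnitaryCfg_gaugeAct hu hU
  have hS0 : SmallField (gaugeAct (axialFn U y) U) a := BlockAverageCurrent.smallField_gaugeAct hu hS
  refine ⟨fun x μ => (mem_U1.mp (mem_U1_of_unitary (hU0 x μ))).1,
    fun x j ν => (mem_U1.mp (mem_U1_of_unitary (hol_mem_of (S := unitaryUnits (Matrix n n ℂ)) hU0 x _))).1,
    fun x j hx => by rw [axial_bond_eq_one U y x j hx, Units.val_one],
    fun x j ν hjν hx => by rw [axial_rec U y x hjν hx, Units.val_mul],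
    fun x j ν hjν => hS0 x j ν (ne_of_lt hjν)⟩

/-- **FIRST DIFFERENCES OF THE TREE-GAUGE BOND VARIABLES** on the region `{y ≤ x, l1(x − y) ≤ S}`:
`‖V₀(x + e_λ, ν) − V₀(x, ν)‖ ≤ d·(S·(2b + 2(S·a)·a) + a)`. [folklore] -/
theorem axial_firstDiff_le {U : Site d → Fin d → (Matrix n n ℂ)ˣ} (hU : IsUnitaryCfg U) {a b : ℝ} (hS : SmallField U a)
    (ha0 : 0 ≤ a) (ha4 : a ≤ 1 / 4) (hb0 : 0 ≤ b)
    (hb : ∀ (x : Site d) (κ : Fin d) (π : T4AveragingDeficitWall.Plane d), ‖covGrad U (flux U) x κ π‖ ≤ b)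
    (y : Site d) (S : ℕ) {x : Site d} (hyx : y ≤ x) (hxS : l1 (x - y) ≤ S) (ν lam : Fin d) :
    ‖((gaugeAct (axialFn U y) U (x + e lam) ν : (Matrix n n ℂ)ˣ) : Matrix n n ℂ) - ((gaugeAct (axialFn U y) U x ν : (Matrix n n ℂ)ˣ) : Matrix n n ℂ)‖
      ≤ d * (S * (2 * b + 2 * ((S : ℝ) * a) * a) + a) := by
  obtain ⟨hW1, hQ1, hT, hRec, hQ0⟩ := axial_hyps hU hS y
  obtain ⟨hU0, hS0, hb0'⟩ := axial_classData hU hS (ha4.trans_lt (by norm_num)) hb y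
  have hp₁ : 0 ≤ 2 * b + 2 * ((S : ℝ) * a) * a := by positivity
  refine norm_firstDiff_le (W := fun x μ => ((gaugeAct (axialFn U y) U x μ : (Matrix n n ℂ)ˣ) : Matrix n n ℂ))
    (Q := fun x j ν => ((hol (gaugeAct (axialFn U y) U) x (plaqWord j ν) : (Matrix n n ℂ)ˣ) : Matrix n n ℂ))
    hW1 hQ1 hT hRec ha0 hp₁ (fun x _ _ j ν hjν => hQ0 x j ν hjν) (fun x hyx' hxS' lam' j ν hjν => ?_) hyx hxS ν lam
  have hα : ‖((gaugeAct (axialFn U y) U x lam' : (Matrix n n ℂ)ˣ) : Matrix n n ℂ) - 1‖ ≤ (S : ℝ) * a :=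
    (norm_axial_sub_one_le hU ha0 hS hyx' lam').trans (mul_le_mul_of_nonneg_right (by exact_mod_cast hxS') ha0)
  exact norm_plaq_diff_le hU0 hS0 ha4 x lam' hjν (hb0' x lam' ⟨(j, ν), hjν⟩) hα

/-- **SECOND DIFFERENCES OF THE TREE-GAUGE BOND VARIABLES** on the region `{y ≤ x, l1(x − y) ≤ R}`: with `p₁ = 2b + 2((R+1)a)a`, `δ = d((R+1)p₁ + a)`,
`‖Δ_λΔ_λ′ V₀(·, ν)(x)‖ ≤ d·(R·(2p₁ + 2p₁δ) + (p₁ + aδ))`. [folklore] -/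
theorem axial_secondDiff_le {U : Site d → Fin d → (Matrix n n ℂ)ˣ} (hU : IsUnitaryCfg U) {a b : ℝ} (hS : SmallField U a)
    (ha0 : 0 ≤ a) (ha4 : a ≤ 1 / 4) (hb0 : 0 ≤ b)
    (hb : ∀ (x : Site d) (κ : Fin d) (π : T4AveragingDeficitWall.Plane d), ‖covGrad U (flux U) x κ π‖ ≤ b)
    (y : Site d) (R : ℕ) {x : Site d} (hyx : y ≤ x) (hxR : l1 (x - y) ≤ R) (ν lam lam' : Fin d) :
    ‖((gaugeAct (axialFn U y) U (x + e lam + e lam') ν : (Matrix n n ℂ)ˣ) : Matrix n n ℂ)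
        - ((gaugeAct (axialFn U y) U (x + e lam) ν : (Matrix n n ℂ)ˣ) : Matrix n n ℂ)
        - ((gaugeAct (axialFn U y) U (x + e lam') ν : (Matrix n n ℂ)ˣ) : Matrix n n ℂ)
        + ((gaugeAct (axialFn U y) U x ν : (Matrix n n ℂ)ˣ) : Matrix n n ℂ)‖
      ≤ d * (R * (2 * (2 * b + 2 * (((R + 1 : ℕ) : ℝ) * a) * a)
              + 2 * (2 * b + 2 * (((R + 1 : ℕ) : ℝ) * a) * a) * (d * ((R + 1 : ℕ) * (2 * b + 2 * (((R + 1 : ℕ) : ℝ) * a) * a) + a)))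
            + ((2 * b + 2 * (((R + 1 : ℕ) : ℝ) * a) * a) + a * (d * ((R + 1 : ℕ) * (2 * b + 2 * (((R + 1 : ℕ) : ℝ) * a) * a) + a)))) := by
  obtain ⟨hW1, hQ1, hT, hRec, hQ0⟩ := axial_hyps hU hS y
  obtain ⟨hU0, hS0, hb0'⟩ := axial_classData hU hS (ha4.trans_lt (by norm_num)) hb y
  set p₁ : ℝ := 2 * b + 2 * (((R + 1 : ℕ) : ℝ) * a) * a with hp₁def
  have hp₁ : 0 ≤ p₁ := by positivity
  set δ : ℝ := d * ((R + 1 : ℕ) * p₁ + a) with hδdef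
  have hδ : 0 ≤ δ := by positivity
  -- the translation discrepancy of the gauged plaquettes on the region of radius `R + 1`
  have hQd : ∀ x : Site d, y ≤ x → l1 (x - y) ≤ R + 1 → ∀ lam j ν : Fin d, j < ν →
      ‖((hol (gaugeAct (axialFn U y) U) (x + e lam) (plaqWord j ν) : (Matrix n n ℂ)ˣ) : Matrix n n ℂ)
        - ((hol (gaugeAct (axialFn U y) U) x (plaqWord j ν) : (Matrix n n ℂ)ˣ) : Matrix n n ℂ)‖ ≤ p₁ := by
    intro x hyx' hxR' lam j ν hjν
    have hα : ‖((gaugeAct (axialFn U y) U x lam : (Matrix n n ℂ)ˣ) : Matrix n n ℂ) - 1‖ ≤ ((R + 1 : ℕ) : ℝ) * a :=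
      (norm_axial_sub_one_le hU ha0 hS hyx' lam).trans (mul_le_mul_of_nonneg_right (by exact_mod_cast hxR') ha0)
    exact norm_plaq_diff_le hU0 hS0 ha4 x lam hjν (hb0' x lam ⟨(j, ν), hjν⟩) hα
  -- first differences on the region of radius `R + 1`
  have hfirst : ∀ x : Site d, y ≤ x → l1 (x - y) ≤ R + 1 → ∀ ν lam : Fin d,
      ‖((gaugeAct (axialFn U y) U (x + e lam) ν : (Matrix n n ℂ)ˣ) : Matrix n n ℂ)
        - ((gaugeAct (axialFn U y) U x ν : (Matrix n n ℂ)ˣ) : Matrix n n ℂ)‖ ≤ δ := by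
    intro x hyx' hxR' ν lam
    have h := norm_firstDiff_le (W := fun x μ => ((gaugeAct (axialFn U y) U x μ : (Matrix n n ℂ)ˣ) : Matrix n n ℂ))
      (Q := fun x j ν => ((hol (gaugeAct (axialFn U y) U) x (plaqWord j ν) : (Matrix n n ℂ)ˣ) : Matrix n n ℂ))
      (S := R + 1) hW1 hQ1 hT hRec ha0 hp₁ (fun x _ _ j ν hjν => hQ0 x j ν hjν) hQd hyx' hxR' ν lam
    simpa [hδdef] using h
  -- mixed second differences of the gauged plaquettes on the region of radius `R`
  have hQ2 : ∀ x : Site d, y ≤ x → l1 (x - y) ≤ R → ∀ lam lam' j ν : Fin d, j < ν →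
      ‖((hol (gaugeAct (axialFn U y) U) (x + e lam + e lam') (plaqWord j ν) : (Matrix n n ℂ)ˣ) : Matrix n n ℂ)
        - ((hol (gaugeAct (axialFn U y) U) (x + e lam) (plaqWord j ν) : (Matrix n n ℂ)ˣ) : Matrix n n ℂ)
        - ((hol (gaugeAct (axialFn U y) U) (x + e lam') (plaqWord j ν) : (Matrix n n ℂ)ˣ) : Matrix n n ℂ)
        + ((hol (gaugeAct (axialFn U y) U) x (plaqWord j ν) : (Matrix n n ℂ)ˣ) : Matrix n n ℂ)‖ ≤ 2 * p₁ := by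
    intro x hyx' hxR' lam lam' j ν hjν
    obtain ⟨hy1, hl1⟩ := region_add_e hyx' hxR' lam'
    have h1 := hQd (x + e lam') hy1 hl1 lam j ν hjν
    have h2 := hQd x hyx' (hxR'.trans (Nat.le_succ _)) lam j ν hjν
    rw [add_right_comm] at h1
    calc _ = ‖(((hol (gaugeAct (axialFn U y) U) (x + e lam + e lam') (plaqWord j ν) : (Matrix n n ℂ)ˣ) : Matrix n n ℂ)
              - ((hol (gaugeAct (axialFn U y) U) (x + e lam') (plaqWord j ν) : (Matrix n n ℂ)ˣ) : Matrix n n ℂ))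
            - (((hol (gaugeAct (axialFn U y) U) (x + e lam) (plaqWord j ν) : (Matrix n n ℂ)ˣ) : Matrix n n ℂ)
              - ((hol (gaugeAct (axialFn U y) U) x (plaqWord j ν) : (Matrix n n ℂ)ˣ) : Matrix n n ℂ))‖ := by
          congr 1; abel
      _ ≤ p₁ + p₁ := (norm_sub_le _ _).trans (add_le_add h1 h2)
      _ = 2 * p₁ := by ring
  have h := norm_secondDiff_le (W := fun x μ => ((gaugeAct (axialFn U y) U x μ : (Matrix n n ℂ)ˣ) : Matrix n n ℂ))
    (Q := fun x j ν => ((hol (gaugeAct (axialFn U y) U) x (plaqWord j ν) : (Matrix n n ℂ)ˣ) : Matrix n n ℂ))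
    (R := R) (p₂ := 2 * p₁) hW1 hQ1 hT hRec ha0 hp₁ (by positivity) hδ (fun x _ _ j ν hjν => hQ0 x j ν hjν) hQd hQ2 hfirst hyx hxR ν lam lam'
  simpa [hp₁def, hδdef] using h

/-! ## §2 The potential `B = log V₀` -/

/-- **THE REPRESENTATION**: wherever `l1(x − y)·a < 1`, `U(x, κ) = (u·expUnit(B)·u⁻¹)(x, κ)` with `u = v₀⁻¹` (unitary) and `B = mlog V₀` bondwise. [folklore] -/
theorem axial_rep {U : Site d → Fin d → (Matrix n n ℂ)ˣ} (hU : IsUnitaryCfg U) {a : ℝ} (ha0 : 0 ≤ a) (hS : SmallField U a)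
    {y x : Site d} (hyx : y ≤ x) (κ : Fin d) (hx1 : (l1 (x - y) : ℝ) * a < 1) :
    U x κ = gaugeAct (fun z => (axialFn U y z)⁻¹)
      (fun z ι => expUnit (mlog ((gaugeAct (axialFn U y) U z ι : (Matrix n n ℂ)ˣ) : Matrix n n ℂ))) x κ := by
  have hlt : ‖((gaugeAct (axialFn U y) U x κ : (Matrix n n ℂ)ˣ) : Matrix n n ℂ) - 1‖ < 1 :=
    (norm_axial_sub_one_le hU ha0 hS hyx κ).trans_lt hx1
  have hexp : expUnit (mlog ((gaugeAct (axialFn U y) U x κ : (Matrix n n ℂ)ˣ) : Matrix n n ℂ)) = gaugeAct (axialFn U y) U x κ :=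
    Units.ext (by rw [val_expUnit, exp_mlog hlt])
  simp only [gaugeAct] at hexp ⊢
  rw [hexp]
  group

/-- **SIZE OF THE POTENTIAL**: `‖B(x, κ)‖ ≤ 2·l1(x − y)·a` wherever `l1(x − y)·a ≤ 1∕2` ([B7] (26)). [folklore] -/
theorem norm_axialLog_le {U : Site d → Fin d → (Matrix n n ℂ)ˣ} (hU : IsUnitaryCfg U) {a : ℝ} (ha0 : 0 ≤ a) (hS : SmallField U a)
    {y x : Site d} (hyx : y ≤ x) (κ : Fin d) (hx2 : (l1 (x - y) : ℝ) * a ≤ 1 / 2) :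
    ‖mlog ((gaugeAct (axialFn U y) U x κ : (Matrix n n ℂ)ˣ) : Matrix n n ℂ)‖ ≤ 2 * ((l1 (x - y) : ℝ) * a) :=
  (norm_mlog_le_two_mul ((norm_axial_sub_one_le hU ha0 hS hyx κ).trans hx2)).trans
    (mul_le_mul_of_nonneg_left (norm_axial_sub_one_le hU ha0 hS hyx κ) (by norm_num))

/-- **FIRST DIFFERENCES OF THE POTENTIAL** on the region `{y ≤ x, l1(x − y) ≤ S}` when `(S + 1)·a ≤ 1∕2`:
`‖B(x + e_ι, κ) − B(x, κ)‖ ≤ 2·d·(S·(2b + 2(S·a)·a) + a)` (the logarithm is `2`-Lipschitz on `‖· − 1‖ ≤ 1∕2`). [folklore] -/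
theorem norm_axialLog_diff_le {U : Site d → Fin d → (Matrix n n ℂ)ˣ} (hU : IsUnitaryCfg U) {a b : ℝ} (hS : SmallField U a)
    (ha0 : 0 ≤ a) (ha4 : a ≤ 1 / 4) (hb0 : 0 ≤ b)
    (hb : ∀ (x : Site d) (κ : Fin d) (π : T4AveragingDeficitWall.Plane d), ‖covGrad U (flux U) x κ π‖ ≤ b)
    (y : Site d) (S : ℕ) (hSa : ((S + 1 : ℕ) : ℝ) * a ≤ 1 / 2) {x : Site d} (hyx : y ≤ x) (hxS : l1 (x - y) ≤ S) (κ ι : Fin d) :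
    ‖mlog ((gaugeAct (axialFn U y) U (x + e ι) κ : (Matrix n n ℂ)ˣ) : Matrix n n ℂ)
        - mlog ((gaugeAct (axialFn U y) U x κ : (Matrix n n ℂ)ˣ) : Matrix n n ℂ)‖
      ≤ 2 * (d * (S * (2 * b + 2 * ((S : ℝ) * a) * a) + a)) := by
  obtain ⟨hy1, hl1⟩ := region_add_e hyx hxS ι
  have hA : ‖((gaugeAct (axialFn U y) U (x + e ι) κ : (Matrix n n ℂ)ˣ) : Matrix n n ℂ) - 1‖ ≤ 1 / 2 :=
    (norm_axial_sub_one_le hU ha0 hS hy1 κ).trans ((mul_le_mul_of_nonneg_right (by exact_mod_cast hl1) ha0).trans hSa)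
  have hB : ‖((gaugeAct (axialFn U y) U x κ : (Matrix n n ℂ)ˣ) : Matrix n n ℂ) - 1‖ ≤ 1 / 2 :=
    (norm_axial_sub_one_le hU ha0 hS hyx κ).trans
      ((mul_le_mul_of_nonneg_right (by exact_mod_cast (hxS.trans (Nat.le_succ _))) ha0).trans hSa)
  have h := norm_mlog_sub_mlog_le (by norm_num : (1 / 2 : ℝ) < 1) hA hB
  have hD := axial_firstDiff_le hU hS ha0 ha4 hb0 hb y S hyx hxS κ ι
  calc _ ≤ ‖((gaugeAct (axialFn U y) U (x + e ι) κ : (Matrix n n ℂ)ˣ) : Matrix n n ℂ)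
            - ((gaugeAct (axialFn U y) U x κ : (Matrix n n ℂ)ˣ) : Matrix n n ℂ)‖ / (1 - 1 / 2) := h
    _ = 2 * ‖((gaugeAct (axialFn U y) U (x + e ι) κ : (Matrix n n ℂ)ˣ) : Matrix n n ℂ)
            - ((gaugeAct (axialFn U y) U x κ : (Matrix n n ℂ)ˣ) : Matrix n n ℂ)‖ := by ring
    _ ≤ _ := mul_le_mul_of_nonneg_left hD (by norm_num)

end

end Summit.QuantumFields.BalabanUV.T4Continuum.NE7AxialGaugePotential
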